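import Summits.CriticalPhenomena.Ising3DConformalLimit.Theses.MonotoneRG
import Summits.CriticalPhenomena.Ising3DConformalLimit.Theorems.ExistsScaleCovariantLimit.Negative.DyadicIdentity
import Summits.CriticalPhenomena.Ising3DConformalLimit.Theorems.MonotoneRGZoomGluePointwise
import Mathlib.Topology.Order.MonotoneConvergence
import HarnessLib

/-!
# Pointwise boundedness + `ZoomMonotone` ⟹ the pinned zoom converges along the integer meshes
(line `Sketch` of the crux `ExistsScaleCovariantLimit`, item stmt-CriticalPhenomena-1981;
stub `stub_intConvergence_of_zoomMonotone`, glue GZ)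

Write `F_n(δ)(x) = rescaledCorrelator (criticalCorr 3) rhoPin n δ x` for the pinned zoom of the critical
`ℤ³` Ising correlators (`rhoPin δ = ⟨σ₀σ_{⌊1/δ⌋e₀}⟩^{-1/2}`). Assume

* POINTWISE BOUNDEDNESS: for every `n` and every `x ∈ NonCoincident 3 n` there is `M` with
  `|F_n(δ)(x)| ≤ M` for all small `δ > 0` (eventually along `𝓝[>] 0`);
* `ZoomMonotone` (route `MonotoneRG`, item stmt-CriticalPhenomena-14454, read as a hypothesis): for every
  `n` and every non-coincident INTEGER configuration `y`, `m ↦ F_n(1/m)(y)` is eventually monotone or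
  eventually antitone (stated with the renormalisation `δ ↦ ⟨σ₀σ_{⌊δ⁻¹⌋e₀}⟩^{-1/2}`, which IS `rhoPin`
  since `⌊δ⁻¹⌋ = ⌊1/δ⌋`).

Then `m ↦ F_n(1/m)(y)` CONVERGES at every non-coincident integer configuration `y`: transport the bound
along `1/m → 0⁺` (`MonotoneRGZoomGlue.tendsto_one_div_natCast`) and apply "eventually monotone +
eventually bounded ⟹ convergent" (`MonotoneRGZoomGlue.tendsto_of_eventually_monotone_of_bounded`).
This is `MonotoneRGZoomGlue.tendsto_intMesh` with clause (a) of `UniformRegularity` weakened to pointwise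
eventual boundedness. No named facts. [folklore]
-/

noncomputable section

namespace Summit.CriticalPhenomena.Ising3DConformalLimit.Cruxes.ExistsScaleCovariantLimit.TwoHierarchies

open Literature.Probability.LatticeModels Filter Set
open scoped Topology
open Summit.CriticalPhenomena.Ising3DConformalLimit.MoebiusLimitExistsOnlyInteraction (rhoPin)
open Summit.CriticalPhenomena.Ising3DConformalLimit.MonotoneRGZoomGlue
  (tendsto_of_eventually_monotone_of_bounded tendsto_one_div_natCast)

/-- **GZ — glue: pointwise boundedness of the pinned zoom + `ZoomMonotone` ⟹ convergence along the
integer meshes `1/m` at every non-coincident integer configuration.** From `ZoomMonotone` get `m₀` and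
eventual (anti)monotonicity of `m ↦ F_n(1/m)(y)` (after rewriting its renormalisation
`δ ↦ ⟨σ₀σ_{⌊δ⁻¹⌋e₀}⟩^{-1/2}` as `rhoPin`); from the boundedness hypothesis at `(n, y)` get `M` with
`|F_n(δ)(y)| ≤ M` eventually as `δ → 0⁺`, pulled back along `1/m → 0⁺` to `∀ᶠ m in atTop`; an eventually
monotone, eventually bounded real sequence converges. [folklore] -/
theorem stub_intConvergence_of_zoomMonotone :
    (∀ n : ℕ, ∀ x ∈ NonCoincident 3 n, ∃ M : ℝ,
      ∀ᶠ δ in 𝓝[>] (0:ℝ), |rescaledCorrelator (criticalCorr 3) rhoPin n δ x| ≤ M) →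
    Summit.CriticalPhenomena.Ising3DConformalLimit.Theses.MonotoneRG.ZoomMonotone →
    ∀ (n : ℕ) (y : Fin n → EuclideanSpace ℝ (Fin 3)), y ∈ NonCoincident 3 n →
      (∀ i j, ∃ z : ℤ, y i j = (z : ℝ)) →
      ∃ L : ℝ, Tendsto (fun m : ℕ => rescaledCorrelator (criticalCorr 3) rhoPin n (1 / (m:ℝ)) y)
        atTop (𝓝 L) := by
  intro hB hZM n y hy hint
  -- eventual (anti)monotonicity from `ZoomMonotone`, with its renormalisation rewritten as `rhoPin`
  obtain ⟨m₀, hmono⟩ := hZM n y hy hint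
  have hρ : (fun δ : ℝ => (criticalTwoPoint 3 (Pi.single 0 ⌊δ⁻¹⌋)) ^ (-(1/2:ℝ))) = rhoPin :=
    funext fun δ => by simp only [rhoPin, one_div]
  rw [hρ] at hmono
  -- eventual boundedness along the integer meshes `1/m → 0⁺`
  obtain ⟨M, hM⟩ := hB n y hy
  have hbd : ∀ᶠ m : ℕ in atTop, |rescaledCorrelator (criticalCorr 3) rhoPin n (1 / (m:ℝ)) y| ≤ M :=
    tendsto_one_div_natCast.eventually hM
  exact tendsto_of_eventually_monotone_of_bounded hmono hbd

end Summit.CriticalPhenomena.Ising3DConformalLimit.Cruxes.ExistsScaleCovariantLimit.TwoHierarchies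

end
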